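import Summits.AtomisticToContinuum.BoseEinsteinCondensation.Theses.BECRewardDescent
import Literature.MathematicalPhysics.QuantumManyBody.PeriodicClusteringFromKyFanGap
import Literature.MathematicalPhysics.QuantumManyBody.CondensateOccupationStability
import HarnessLib

/-!
# `RewardChordBound` (stmt-AtomisticToContinuum-12876), line `registered`, stub 5 `noKinkOfSimple` —
# helpers: clustering of near-minimisers of the REWARDED torus functional from a strict Ky-Fan gap

The model theorem `Literature…BoseGas.exists_phase_integral_norm_sub_sq_le_of_kyFanGap` (Ky-Fan gap ⇒
any two near-minimisers are `L²(cell)`-close up to a phase; parallelogram law, no spectral theory) is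
stated for the bare energy. Here it is re-run for an ABSTRACT functional `F` on periodic trial states
that is the restriction (`Q Ψ.ψ = F Ψ`) of a functional `Q` on `C¹` functions with the scaling law
`Q(cχ) = |c|² Q(χ)` and the (sub-)parallelogram law `Q(φ+ψ) + Q(φ-ψ) ≤ 2Q(φ) + 2Q(ψ)`
(`NoKink.exists_phase_sq_dist_le_of_kyFanGap`), and instantiated for the rewarded functional
`F_s(Ψ) = ⟨Ψ,HΨ⟩ + s·(N − ⟨Ψ,n̂₀Ψ⟩)` of route `BECRewardDescent`, whose quadratic extension is
`Q_s(χ) = q(χ) + s·(N‖χ‖² − n₀(χ))` (`NoKink.rewardForm_*`; registered helper stub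
`stub_noKinkOfSimpleRewardClustering`). New input: the parallelogram law of the bounded quadratic
form `n₀ = ‖a₀·‖²` (`NoKink.condensateOccupation_add_add_sub`, linearity of `a₀ = modeAn`).
References: Ky Fan (1949) Thm. 1; [ReedSimonIV1978] Thm. XIII.1–2; [LSSY2005] App. A (A.11), (A.13).
-/

noncomputable section

open MeasureTheory Filter
open scoped ENNReal NNReal ComplexConjugate

namespace Summit.AtomisticToContinuum.BoseEinsteinCondensation.Cruxes.RewardChordBound.Birth

open Literature.MathematicalPhysics.QuantumManyBody.BoseGas

namespace NoKink

variable {N : ℕ} {L : ℝ}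

/-! ### Abstract clustering from a Ky-Fan gap -/

/-- **Clustering of near-minimisers from a Ky-Fan gap, for an abstract quadratic functional.**
Let `F` be a functional on periodic trial states which is the restriction of a functional `Q` on
`C¹` functions with `Q(cχ) = |c|²Q(χ)` and `Q(φ+ψ) + Q(φ-ψ) ≤ 2Q(φ) + 2Q(ψ)`. If
`E₀ = inf F < ∞` and `2E₀ + γ ≤ F(Φ₁) + F(Φ₂)` for all `L²(cell)`-orthogonal pairs (`γ > 0`), then
any two trial states with `F ≤ E₀ + γη/16` satisfy `∫_cell |Φ − e^{iθ}Φ'|² ≤ η` for some phase.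
Proof: verbatim the parallelogram argument of
`exists_phase_integral_norm_sub_sq_le_of_kyFanGap`. [folklore] -/
theorem exists_phase_sq_dist_le_of_kyFanGap
    (F : PeriodicTrialState N L → ℝ≥0∞) (Q : (Config N → ℂ) → ℝ≥0∞)
    (hQF : ∀ Ψ : PeriodicTrialState N L, Q Ψ.ψ = F Ψ)
    (hQsmul : ∀ (c : ℂ) (χ : Config N → ℂ), ContDiff ℝ 1 χ →
      Q (fun X => c * χ X) = ((‖c‖₊ : ℝ≥0∞)) ^ 2 * Q χ)
    (hQpar : ∀ (φ ψ : Config N → ℂ), ContDiff ℝ 1 φ → ContDiff ℝ 1 ψ →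
      Q (fun X => φ X + ψ X) + Q (fun X => φ X - ψ X) ≤ 2 * Q φ + 2 * Q ψ)
    {γ : ℝ} (hγ : 0 < γ) (hE : (⨅ Ψ, F Ψ) ≠ ⊤)
    (hgap : ∀ Φ₁ Φ₂ : PeriodicTrialState N L,
      (∫ X in cellN N L, conj (Φ₁.ψ X) * Φ₂.ψ X) = 0 →
        2 * (⨅ Ψ, F Ψ) + ENNReal.ofReal γ ≤ F Φ₁ + F Φ₂)
    {η : ℝ} (hη : 0 < η) (Φ Φ' : PeriodicTrialState N L)
    (hΦ : F Φ ≤ (⨅ Ψ, F Ψ) + ENNReal.ofReal (γ * η / 16))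
    (hΦ' : F Φ' ≤ (⨅ Ψ, F Ψ) + ENNReal.ofReal (γ * η / 16)) :
    ∃ θ : ℝ, ∫ X in cellN N L, ‖Φ.ψ X - Complex.exp (θ * Complex.I) * Φ'.ψ X‖ ^ 2 ≤ η := by
  set E₀ : ℝ≥0∞ := ⨅ Ψ, F Ψ with hE₀
  -- the phase aligning `Φ'` with `Φ`
  set s : ℂ := ∫ X in cellN N L, conj (Φ'.ψ X) * Φ.ψ X with hs
  set c : ℂ := Complex.exp (↑(Complex.arg s) * Complex.I) with hc
  have hcc : conj c * c = 1 := by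
    rw [Complex.conj_mul', Complex.norm_exp_ofReal_mul_I, Complex.ofReal_one, one_pow]
  have hs_polar : s = ↑‖s‖ * c := by rw [hc]; exact (Complex.norm_mul_exp_arg_mul_I s).symm
  have hcs : conj c * s = (‖s‖ : ℂ) := by
    calc conj c * s = conj c * (↑‖s‖ * c) := by rw [← hs_polar]
      _ = ↑‖s‖ * (conj c * c) := by ring
      _ = ↑‖s‖ := by rw [hcc, mul_one]
  -- regularity of `Φ`, `cΦ'`, `u = Φ + cΦ'`, `w = Φ - cΦ'`
  have hΦc : Continuous Φ.ψ := Φ.contDiff.continuous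
  have hΦ'c : Continuous Φ'.ψ := Φ'.contDiff.continuous
  have hcΦ' : ContDiff ℝ 1 (fun X => c * Φ'.ψ X) := contDiff_const.mul Φ'.contDiff
  have hCu : ContDiff ℝ 1 (fun X => Φ.ψ X + c * Φ'.ψ X) := Φ.contDiff.add hcΦ'
  have hCw : ContDiff ℝ 1 (fun X => Φ.ψ X - c * Φ'.ψ X) := Φ.contDiff.sub hcΦ'
  have hper_u : ∀ (X : Config N) (i : Fin N) (k : Fin 3),
      Φ.ψ (X + Pi.single i (EuclideanSpace.single k L)) +
          c * Φ'.ψ (X + Pi.single i (EuclideanSpace.single k L)) = Φ.ψ X + c * Φ'.ψ X :=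
    fun X i k => by rw [Φ.periodic, Φ'.periodic]
  have hper_w : ∀ (X : Config N) (i : Fin N) (k : Fin 3),
      Φ.ψ (X + Pi.single i (EuclideanSpace.single k L)) -
          c * Φ'.ψ (X + Pi.single i (EuclideanSpace.single k L)) = Φ.ψ X - c * Φ'.ψ X :=
    fun X i k => by rw [Φ.periodic, Φ'.periodic]
  have hsymm_u : ∀ (σ : Equiv.Perm (Fin N)) (X : Config N),
      Φ.ψ (X ∘ σ) + c * Φ'.ψ (X ∘ σ) = Φ.ψ X + c * Φ'.ψ X :=
    fun σ X => by rw [Φ.symm, Φ'.symm]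
  have hsymm_w : ∀ (σ : Equiv.Perm (Fin N)) (X : Config N),
      Φ.ψ (X ∘ σ) - c * Φ'.ψ (X ∘ σ) = Φ.ψ X - c * Φ'.ψ X :=
    fun σ X => by rw [Φ.symm, Φ'.symm]
  -- `‖cΦ'‖² = 1`, `Q(cΦ') = F(Φ')`
  have hc2 : ((‖c‖₊ : ℝ≥0∞)) ^ 2 = 1 := coe_nnnorm_exp_mul_I_sq _
  have hnΦ'' : ∫⁻ X in cellN N L, ((‖c * Φ'.ψ X‖₊ : ℝ≥0∞)) ^ 2 = 1 := by
    rw [lintegral_cellN_sq_const_mul, Φ'.norm_eq, mul_one, hc2]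
  have hEΦ'' : Q (fun X => c * Φ'.ψ X) = F Φ' := by
    rw [hQsmul c Φ'.ψ Φ'.contDiff, hc2, one_mul, hQF]
  -- (F1) `‖u‖² + ‖w‖² = 4`
  have hpm : (∫⁻ X in cellN N L, ((‖Φ.ψ X + c * Φ'.ψ X‖₊ : ℝ≥0∞)) ^ 2) +
      (∫⁻ X in cellN N L, ((‖Φ.ψ X - c * Φ'.ψ X‖₊ : ℝ≥0∞)) ^ 2) = 4 := by
    rw [lintegral_cellN_sq_add_add_sub L hΦc hcΦ'.continuous, Φ.norm_eq, hnΦ'']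
    norm_num
  -- (F2) `Q(u) + Q(w) ≤ 4E₀ + 4δ`
  have hab : Q (fun X => Φ.ψ X + c * Φ'.ψ X) + Q (fun X => Φ.ψ X - c * Φ'.ψ X) ≤
      4 * E₀ + 4 * ENNReal.ofReal (γ * η / 16) := by
    calc _ ≤ 2 * Q Φ.ψ + 2 * Q (fun X => c * Φ'.ψ X) := hQpar _ _ Φ.contDiff hcΦ'
      _ = 2 * F Φ + 2 * F Φ' := by rw [hQF, hEΦ'']
      _ ≤ 2 * (E₀ + ENNReal.ofReal (γ * η / 16)) + 2 * (E₀ + ENNReal.ofReal (γ * η / 16)) := by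
          gcongr
      _ = _ := by ring
  -- (F3) `u ⊥ w` in `L²(cell)`
  have hUW : ∫ X in cellN N L, conj (Φ.ψ X + c * Φ'.ψ X) * (Φ.ψ X - c * Φ'.ψ X) = 0 := by
    have hprod : (fun X => conj (Φ.ψ X + c * Φ'.ψ X) * (Φ.ψ X - c * Φ'.ψ X)) =
        fun X => (conj (Φ.ψ X) * Φ.ψ X - conj c * c * (conj (Φ'.ψ X) * Φ'.ψ X)) +
          (conj c * (conj (Φ'.ψ X) * Φ.ψ X) - conj (conj c * (conj (Φ'.ψ X) * Φ.ψ X))) := by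
      funext X; simp only [map_mul, map_add, Complex.conj_conj]; ring
    have hi1 : IntegrableOn (fun X => conj (Φ.ψ X) * Φ.ψ X) (cellN N L) :=
      integrableOn_cellN (hΦc.star.mul hΦc) L
    have hi4 : IntegrableOn (fun X => conj c * c * (conj (Φ'.ψ X) * Φ'.ψ X)) (cellN N L) :=
      integrableOn_cellN (continuous_const.mul (hΦ'c.star.mul hΦ'c)) L
    have hi3 : IntegrableOn (fun X => conj c * (conj (Φ'.ψ X) * Φ.ψ X)) (cellN N L) :=
      integrableOn_cellN (continuous_const.mul (hΦ'c.star.mul hΦc)) L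
    have hi2 : IntegrableOn (fun X => conj (conj c * (conj (Φ'.ψ X) * Φ.ψ X))) (cellN N L) :=
      integrableOn_cellN (continuous_const.mul (hΦ'c.star.mul hΦc)).star L
    have hi14 : IntegrableOn (fun X => conj (Φ.ψ X) * Φ.ψ X -
        conj c * c * (conj (Φ'.ψ X) * Φ'.ψ X)) (cellN N L) := hi1.sub hi4
    have hi32 : IntegrableOn (fun X => conj c * (conj (Φ'.ψ X) * Φ.ψ X) -
        conj (conj c * (conj (Φ'.ψ X) * Φ.ψ X))) (cellN N L) := hi3.sub hi2
    rw [hprod, integral_add hi14 hi32, integral_sub hi1 hi4, integral_sub hi3 hi2,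
      integral_const_mul, integral_const_mul, integral_conj, integral_const_mul,
      integral_cellN_conj_mul_self_trialState, integral_cellN_conj_mul_self_trialState, ← hs, hcs,
      hcc, Complex.conj_ofReal]
    ring
  -- values of `F` on the normalised states
  have hEnorm : ∀ (U : Config N → ℂ), ContDiff ℝ 1 U → ∀ (Ψ : PeriodicTrialState N L) (a : ℝ),
      (Ψ.ψ = fun X => (a : ℂ) * U X) → F Ψ = ((‖(a : ℂ)‖₊ : ℝ≥0∞)) ^ 2 * Q U := by
    intro U hU Ψ a h
    rw [← hQF, h, hQsmul _ U hU]
  -- (F4) `E₀ ‖u‖² ≤ Q(u)` and `E₀ ‖w‖² ≤ Q(w)`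
  have hFa : (∫⁻ X in cellN N L, ((‖Φ.ψ X + c * Φ'.ψ X‖₊ : ℝ≥0∞)) ^ 2) ≠ 0 →
      E₀ * (∫⁻ X in cellN N L, ((‖Φ.ψ X + c * Φ'.ψ X‖₊ : ℝ≥0∞)) ^ 2) ≤
        Q (fun X => Φ.ψ X + c * Φ'.ψ X) := by
    intro hp0
    have hp_top : (∫⁻ X in cellN N L, ((‖Φ.ψ X + c * Φ'.ψ X‖₊ : ℝ≥0∞)) ^ 2) ≠ ⊤ :=
      ne_top_of_le_ne_top (by norm_num) (hpm ▸ le_self_add)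
    obtain ⟨û, a, hûψ, ha⟩ := exists_periodicTrialState_const_mul hCu hper_u hsymm_u hp0 hp_top
    have hEu := hEnorm _ hCu û a hûψ
    rw [ha] at hEu
    calc _ ≤ F û * _ := mul_le_mul' (iInf_le _ û) le_rfl
      _ = _ := by rw [hEu, mul_comm _⁻¹, mul_assoc, ENNReal.inv_mul_cancel hp0 hp_top, mul_one]
  have hFb : (∫⁻ X in cellN N L, ((‖Φ.ψ X - c * Φ'.ψ X‖₊ : ℝ≥0∞)) ^ 2) ≠ 0 →
      E₀ * (∫⁻ X in cellN N L, ((‖Φ.ψ X - c * Φ'.ψ X‖₊ : ℝ≥0∞)) ^ 2) ≤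
        Q (fun X => Φ.ψ X - c * Φ'.ψ X) := by
    intro hm0
    have hm_top : (∫⁻ X in cellN N L, ((‖Φ.ψ X - c * Φ'.ψ X‖₊ : ℝ≥0∞)) ^ 2) ≠ ⊤ :=
      ne_top_of_le_ne_top (by norm_num) (hpm ▸ le_add_self)
    obtain ⟨ŵ, b, hŵψ, hb⟩ := exists_periodicTrialState_const_mul hCw hper_w hsymm_w hm0 hm_top
    have hEw := hEnorm _ hCw ŵ b hŵψ
    rw [hb] at hEw
    calc _ ≤ F ŵ * _ := mul_le_mul' (iInf_le _ ŵ) le_rfl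
      _ = _ := by rw [hEw, mul_comm _⁻¹, mul_assoc, ENNReal.inv_mul_cancel hm0 hm_top, mul_one]
  -- (F5) the Ky Fan gap tested on the orthogonal pair `û, ŵ`
  have hF5 : (∫⁻ X in cellN N L, ((‖Φ.ψ X + c * Φ'.ψ X‖₊ : ℝ≥0∞)) ^ 2) ≠ 0 →
      (∫⁻ X in cellN N L, ((‖Φ.ψ X - c * Φ'.ψ X‖₊ : ℝ≥0∞)) ^ 2) ≠ 0 →
      2 * E₀ + ENNReal.ofReal γ ≤
        (∫⁻ X in cellN N L, ((‖Φ.ψ X + c * Φ'.ψ X‖₊ : ℝ≥0∞)) ^ 2)⁻¹ *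
          Q (fun X => Φ.ψ X + c * Φ'.ψ X) +
        (∫⁻ X in cellN N L, ((‖Φ.ψ X - c * Φ'.ψ X‖₊ : ℝ≥0∞)) ^ 2)⁻¹ *
          Q (fun X => Φ.ψ X - c * Φ'.ψ X) := by
    intro hp0 hm0
    have hp_top : (∫⁻ X in cellN N L, ((‖Φ.ψ X + c * Φ'.ψ X‖₊ : ℝ≥0∞)) ^ 2) ≠ ⊤ :=
      ne_top_of_le_ne_top (by norm_num) (hpm ▸ le_self_add)
    have hm_top : (∫⁻ X in cellN N L, ((‖Φ.ψ X - c * Φ'.ψ X‖₊ : ℝ≥0∞)) ^ 2) ≠ ⊤ :=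
      ne_top_of_le_ne_top (by norm_num) (hpm ▸ le_add_self)
    obtain ⟨û, a, hûψ, ha⟩ := exists_periodicTrialState_const_mul hCu hper_u hsymm_u hp0 hp_top
    obtain ⟨ŵ, b, hŵψ, hb⟩ := exists_periodicTrialState_const_mul hCw hper_w hsymm_w hm0 hm_top
    have hEu := hEnorm _ hCu û a hûψ
    rw [ha] at hEu
    have hEw := hEnorm _ hCw ŵ b hŵψ
    rw [hb] at hEw
    have horth : ∫ X in cellN N L, conj (û.ψ X) * ŵ.ψ X = 0 := by
      rw [hûψ, hŵψ]
      have h2 : (fun X => conj ((a : ℂ) * (Φ.ψ X + c * Φ'.ψ X)) * ((b : ℂ) * (Φ.ψ X - c * Φ'.ψ X))) =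
          fun X => (conj (a : ℂ) * b) * (conj (Φ.ψ X + c * Φ'.ψ X) * (Φ.ψ X - c * Φ'.ψ X)) := by
        funext X; simp only [map_mul]; ring
      rw [h2, integral_const_mul, hUW, mul_zero]
    calc 2 * E₀ + ENNReal.ofReal γ ≤ F û + F ŵ := hgap û ŵ horth
      _ = _ := by rw [hEu, hEw]
  -- bookkeeping: `min(‖u‖², ‖w‖²) ≤ 8δ/γ = η/2`
  have key := min_toReal_le_of_kyFan_bookkeeping hγ (by positivity : (0 : ℝ) ≤ γ * η / 16) hE hpm
    hab hFa hFb hF5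
  have key' : min (∫⁻ X in cellN N L, ((‖Φ.ψ X + c * Φ'.ψ X‖₊ : ℝ≥0∞)) ^ 2).toReal
      (∫⁻ X in cellN N L, ((‖Φ.ψ X - c * Φ'.ψ X‖₊ : ℝ≥0∞)) ^ 2).toReal ≤ η := by
    calc _ ≤ 8 * (γ * η / 16) / γ := key
      _ = η / 2 := by field_simp; ring
      _ ≤ η := by linarith
  rcases le_total (∫⁻ X in cellN N L, ((‖Φ.ψ X - c * Φ'.ψ X‖₊ : ℝ≥0∞)) ^ 2).toReal
    (∫⁻ X in cellN N L, ((‖Φ.ψ X + c * Φ'.ψ X‖₊ : ℝ≥0∞)) ^ 2).toReal with h | h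
  · -- `w = Φ - cΦ'` is the small one: `θ = arg s`
    refine ⟨Complex.arg s, ?_⟩
    rw [← hc, integral_cellN_norm_sq_eq_toReal L (F := fun X => Φ.ψ X - c * Φ'.ψ X)
      (hΦc.sub hcΦ'.continuous)]
    exact (min_eq_right h ▸ key')
  · -- `u = Φ + cΦ'` is the small one: `θ = arg s + π`
    refine ⟨Complex.arg s + Real.pi, ?_⟩
    have hneg : Complex.exp (↑(Complex.arg s + Real.pi) * Complex.I) = -c := by
      rw [Complex.ofReal_add, add_mul, Complex.exp_add, Complex.exp_pi_mul_I, hc, mul_neg_one]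
    simp_rw [hneg, neg_mul, sub_neg_eq_add]
    rw [integral_cellN_norm_sq_eq_toReal L (F := fun X => Φ.ψ X + c * Φ'.ψ X)
      (hΦc.add hcΦ'.continuous)]
    exact (min_eq_left h ▸ key')


/-! ### The condensate occupation is a quadratic form: parallelogram law -/

/-- `a₀(φ + ψ) = a₀φ + a₀ψ` pointwise for continuous `φ, ψ` (additivity of `a₀ = modeAn` on
functions with integrable slices). [cite: LSSY2005, App. A (A.13)] -/
theorem modeAn_constantMode_fun_add {n : ℕ} (L : ℝ) {φ ψ : Config (n + 1) → ℂ}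
    (hφ : Continuous φ) (hψ : Continuous ψ) (Y : Config n) :
    modeAn L (constantMode L) (fun X => φ X + ψ X) Y =
      modeAn L (constantMode L) φ Y + modeAn L (constantMode L) ψ Y := by
  simp only [modeAn, mul_add]
  rw [integral_add (integrableOn_cell_conj_mul (measurable_constantMode L) (norm_constantMode_le L)
      (continuous_vecCons_slice hφ Y)) (integrableOn_cell_conj_mul (measurable_constantMode L)
      (norm_constantMode_le L) (continuous_vecCons_slice hψ Y)), mul_add]

/-- `a₀(φ - ψ) = a₀φ - a₀ψ` pointwise for continuous `φ, ψ`. [cite: LSSY2005, App. A (A.13)] -/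
theorem modeAn_constantMode_fun_sub {n : ℕ} (L : ℝ) {φ ψ : Config (n + 1) → ℂ}
    (hφ : Continuous φ) (hψ : Continuous ψ) (Y : Config n) :
    modeAn L (constantMode L) (fun X => φ X - ψ X) Y =
      modeAn L (constantMode L) φ Y - modeAn L (constantMode L) ψ Y := by
  simp only [modeAn, mul_sub]
  rw [integral_sub (integrableOn_cell_conj_mul (measurable_constantMode L) (norm_constantMode_le L)
      (continuous_vecCons_slice hφ Y)) (integrableOn_cell_conj_mul (measurable_constantMode L)
      (norm_constantMode_le L) (continuous_vecCons_slice hψ Y)), mul_sub]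

/-- **Parallelogram law for the condensate occupation** `n₀ = ‖a₀·‖²`:
`n₀(φ+ψ) + n₀(φ-ψ) = 2n₀(φ) + 2n₀(ψ)` for continuous `N`-body functions (linearity of `a₀` and
the parallelogram law in `ℂ` under the integral). [cite: LSSY2005, App. A (A.11), (A.13)] -/
theorem condensateOccupation_add_add_sub (L : ℝ) {φ ψ : Config N → ℂ} (hφ : Continuous φ)
    (hψ : Continuous ψ) :
    condensateOccupation N L (fun X => φ X + ψ X) + condensateOccupation N L (fun X => φ X - ψ X) =
      2 * condensateOccupation N L φ + 2 * condensateOccupation N L ψ := by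
  cases N with
  | zero => simp [condensateOccupation, occupation]
  | succ n =>
    simp only [condensateOccupation_eq_lintegral_modeAn_constantMode]
    have hmeas : ∀ {χ : Config (n + 1) → ℂ}, Continuous χ →
        Measurable fun Y => ((‖modeAn L (constantMode L) χ Y‖₊ : ℝ≥0∞)) ^ 2 := fun hχ =>
      ((measurable_modeAn L (measurable_constantMode L) hχ.measurable).nnnorm.coe_nnreal_ennreal).pow_const
        2
    have H : ∫⁻ Y in cellN n L, (((‖modeAn L (constantMode L) (fun X => φ X + ψ X) Y‖₊ : ℝ≥0∞)) ^ 2 +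
          ((‖modeAn L (constantMode L) (fun X => φ X - ψ X) Y‖₊ : ℝ≥0∞)) ^ 2) =
        ∫⁻ Y in cellN n L, (2 * ((‖modeAn L (constantMode L) φ Y‖₊ : ℝ≥0∞)) ^ 2 +
          2 * ((‖modeAn L (constantMode L) ψ Y‖₊ : ℝ≥0∞)) ^ 2) := by
      refine lintegral_congr fun Y => ?_
      rw [modeAn_constantMode_fun_add L hφ hψ Y, modeAn_constantMode_fun_sub L hφ hψ Y,
        ennreal_sq_nnnorm_add_add_sub, mul_add]
    rw [lintegral_add_left (hmeas (χ := fun X => φ X + ψ X) (hφ.add hψ)),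
      lintegral_add_left ((hmeas hφ).const_mul 2),
      lintegral_const_mul _ (hmeas hφ), lintegral_const_mul _ (hmeas hψ)] at H
    exact H

/-- The subtraction bookkeeping of the parallelogram law for a difference of quadratic forms in
`ℝ≥0∞`: if `A + A' = 2B + 2B'`, `a + a' = 2b + 2b'` with `a ≤ A`, `a' ≤ A'`, `b ≤ B`, `b' ≤ B'` and
`a, a'` finite, then `(A - a) + (A' - a') = 2(B - b) + 2(B' - b')`. [folklore] -/
theorem tsub_add_tsub_of_parallelogram {A A' B B' a a' b b' : ℝ≥0∞} (hA : A + A' = 2 * B + 2 * B')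
    (ha : a + a' = 2 * b + 2 * b') (haA : a ≤ A) (haA' : a' ≤ A') (hbB : b ≤ B) (hbB' : b' ≤ B')
    (hat : a ≠ ⊤) (hat' : a' ≠ ⊤) : (A - a) + (A' - a') = 2 * (B - b) + 2 * (B' - b') := by
  have hc : a + a' ≠ ⊤ := ENNReal.add_ne_top.2 ⟨hat, hat'⟩
  refine (ENNReal.add_left_inj hc).1 ?_
  calc (A - a) + (A' - a') + (a + a') = (A - a + a) + (A' - a' + a') := by ring
    _ = A + A' := by rw [tsub_add_cancel_of_le haA, tsub_add_cancel_of_le haA']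
    _ = 2 * B + 2 * B' := hA
    _ = 2 * (B - b + b) + 2 * (B' - b' + b') := by
        rw [tsub_add_cancel_of_le hbB, tsub_add_cancel_of_le hbB']
    _ = 2 * (B - b) + 2 * (B' - b') + (2 * b + 2 * b') := by ring
    _ = 2 * (B - b) + 2 * (B' - b') + (a + a') := by rw [ha]

/-! ### The rewarded functional as a quadratic form on `C¹` functions -/

variable {v : ℝ → ℝ≥0∞}

/-- **Scaling law for the rewarded form** `Q_s(χ) = q(χ) + s·(N‖χ‖² − n₀(χ))`:
`Q_s(cχ) = |c|² Q_s(χ)`. [folklore] -/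
theorem rewardForm_const_mul (v : ℝ → ℝ≥0∞) (L : ℝ) (s : ℝ) (c : ℂ) {χ : Config N → ℂ}
    (hχ : ContDiff ℝ 1 χ) :
    (∫⁻ X in cellN N L, kineticDensity (fun Y => c * χ Y) X +
        periodicInteraction v L X * ((‖c * χ X‖₊ : ℝ≥0∞)) ^ 2) +
      ENNReal.ofReal s * ((N : ℝ≥0∞) * (∫⁻ X in cellN N L, ((‖c * χ X‖₊ : ℝ≥0∞)) ^ 2) -
        condensateOccupation N L (fun X => c * χ X)) =
    ((‖c‖₊ : ℝ≥0∞)) ^ 2 * ((∫⁻ X in cellN N L, kineticDensity χ X +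
        periodicInteraction v L X * ((‖χ X‖₊ : ℝ≥0∞)) ^ 2) +
      ENNReal.ofReal s * ((N : ℝ≥0∞) * (∫⁻ X in cellN N L, ((‖χ X‖₊ : ℝ≥0∞)) ^ 2) -
        condensateOccupation N L χ)) := by
  rw [lintegral_periodicEnergy_const_mul v L c hχ, lintegral_cellN_sq_const_mul,
    condensateOccupation_const_mul, mul_left_comm (N : ℝ≥0∞),
    ← ENNReal.mul_sub (fun _ _ => ENNReal.pow_ne_top ENNReal.coe_ne_top)]
  ring

/-- `N ∫_cell |χ|² < ∞` for a continuous `χ` (bounded cell). [folklore] -/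
theorem natCast_mul_lintegral_cellN_ne_top (N : ℕ) (L : ℝ) {χ : Config N → ℂ} (hχ : Continuous χ) :
    (N : ℝ≥0∞) * (∫⁻ X in cellN N L, ((‖χ X‖₊ : ℝ≥0∞)) ^ 2) ≠ ⊤ :=
  ENNReal.mul_ne_top (ENNReal.natCast_ne_top N)
    (by rw [lintegral_cellN_nnnorm_sq_eq_ofReal L hχ]; exact ENNReal.ofReal_ne_top)

/-- **Parallelogram law for the rewarded form** (`L > 0`, `v` measurable, all `s`):
`Q_s(φ+ψ) + Q_s(φ-ψ) = 2Q_s(φ) + 2Q_s(ψ)` for `C¹` functions, from the parallelogram laws of the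
energy, of the cell norm and of `n₀`, the bound `n₀ ≤ N‖·‖²` making the truncated subtraction
honest. [folklore] -/
theorem rewardForm_add_add_sub (hv : Measurable v) (hL : 0 < L) (s : ℝ) {φ ψ : Config N → ℂ}
    (hφ : ContDiff ℝ 1 φ) (hψ : ContDiff ℝ 1 ψ) :
    ((∫⁻ X in cellN N L, kineticDensity (fun Y => φ Y + ψ Y) X +
        periodicInteraction v L X * ((‖φ X + ψ X‖₊ : ℝ≥0∞)) ^ 2) +
      ENNReal.ofReal s * ((N : ℝ≥0∞) * (∫⁻ X in cellN N L, ((‖φ X + ψ X‖₊ : ℝ≥0∞)) ^ 2) -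
        condensateOccupation N L (fun X => φ X + ψ X))) +
    ((∫⁻ X in cellN N L, kineticDensity (fun Y => φ Y - ψ Y) X +
        periodicInteraction v L X * ((‖φ X - ψ X‖₊ : ℝ≥0∞)) ^ 2) +
      ENNReal.ofReal s * ((N : ℝ≥0∞) * (∫⁻ X in cellN N L, ((‖φ X - ψ X‖₊ : ℝ≥0∞)) ^ 2) -
        condensateOccupation N L (fun X => φ X - ψ X))) =
    2 * ((∫⁻ X in cellN N L, kineticDensity φ X +
        periodicInteraction v L X * ((‖φ X‖₊ : ℝ≥0∞)) ^ 2) +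
      ENNReal.ofReal s * ((N : ℝ≥0∞) * (∫⁻ X in cellN N L, ((‖φ X‖₊ : ℝ≥0∞)) ^ 2) -
        condensateOccupation N L φ)) +
    2 * ((∫⁻ X in cellN N L, kineticDensity ψ X +
        periodicInteraction v L X * ((‖ψ X‖₊ : ℝ≥0∞)) ^ 2) +
      ENNReal.ofReal s * ((N : ℝ≥0∞) * (∫⁻ X in cellN N L, ((‖ψ X‖₊ : ℝ≥0∞)) ^ 2) -
        condensateOccupation N L ψ)) := by
  have hφc : Continuous φ := hφ.continuous
  have hψc : Continuous ψ := hψ.continuous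
  have hq := lintegral_periodicEnergy_add_add_sub hv L hφ hψ
  have hm := lintegral_cellN_sq_add_add_sub L hφc hψc
  have hn := condensateOccupation_add_add_sub L hφc hψc
  have hA : (N : ℝ≥0∞) * (∫⁻ X in cellN N L, ((‖φ X + ψ X‖₊ : ℝ≥0∞)) ^ 2) +
      (N : ℝ≥0∞) * (∫⁻ X in cellN N L, ((‖φ X - ψ X‖₊ : ℝ≥0∞)) ^ 2) =
      2 * ((N : ℝ≥0∞) * ∫⁻ X in cellN N L, ((‖φ X‖₊ : ℝ≥0∞)) ^ 2) +
      2 * ((N : ℝ≥0∞) * ∫⁻ X in cellN N L, ((‖ψ X‖₊ : ℝ≥0∞)) ^ 2) := by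
    rw [← mul_add, hm]; ring
  have key := tsub_add_tsub_of_parallelogram hA hn
    (condensateOccupation_le_card_mul_lintegral hL (hφc.add hψc))
    (condensateOccupation_le_card_mul_lintegral hL (hφc.sub hψc))
    (condensateOccupation_le_card_mul_lintegral hL hφc)
    (condensateOccupation_le_card_mul_lintegral hL hψc)
    (ne_top_of_le_ne_top (natCast_mul_lintegral_cellN_ne_top N L (hφc.add hψc))
      (condensateOccupation_le_card_mul_lintegral hL (hφc.add hψc)))
    (ne_top_of_le_ne_top (natCast_mul_lintegral_cellN_ne_top N L (hφc.sub hψc))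
      (condensateOccupation_le_card_mul_lintegral hL (hφc.sub hψc)))
  calc _ = ((∫⁻ X in cellN N L, kineticDensity (fun Y => φ Y + ψ Y) X +
          periodicInteraction v L X * ((‖φ X + ψ X‖₊ : ℝ≥0∞)) ^ 2) +
        (∫⁻ X in cellN N L, kineticDensity (fun Y => φ Y - ψ Y) X +
          periodicInteraction v L X * ((‖φ X - ψ X‖₊ : ℝ≥0∞)) ^ 2)) +
        ENNReal.ofReal s *
          (((N : ℝ≥0∞) * (∫⁻ X in cellN N L, ((‖φ X + ψ X‖₊ : ℝ≥0∞)) ^ 2) -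
              condensateOccupation N L (fun X => φ X + ψ X)) +
            ((N : ℝ≥0∞) * (∫⁻ X in cellN N L, ((‖φ X - ψ X‖₊ : ℝ≥0∞)) ^ 2) -
              condensateOccupation N L (fun X => φ X - ψ X))) := by ring
    _ = _ := by rw [hq, key]; ring

/-- On a periodic trial state the rewarded form is the route's rewarded functional
`F_s(Ψ) = ⟨Ψ,HΨ⟩ + s·(N − n₀(Ψ))` (`‖Ψ‖²_cell = 1`). [folklore] -/
theorem rewardForm_trialState (v : ℝ → ℝ≥0∞) (s : ℝ) (Ψ : PeriodicTrialState N L) :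
    (∫⁻ X in cellN N L, kineticDensity Ψ.ψ X + periodicInteraction v L X * ((‖Ψ.ψ X‖₊ : ℝ≥0∞)) ^ 2) +
      ENNReal.ofReal s * ((N : ℝ≥0∞) * (∫⁻ X in cellN N L, ((‖Ψ.ψ X‖₊ : ℝ≥0∞)) ^ 2) -
        condensateOccupation N L Ψ.ψ) =
    periodicEnergy v Ψ + ENNReal.ofReal s * ((N : ℝ≥0∞) - condensateOccupation N L Ψ.ψ) := by
  rw [Ψ.norm_eq, mul_one]
  rfl

end NoKink

/-- **Registered helper stub `stub_noKinkOfSimpleRewardClustering`** (sub-goal of stub 5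
`stub_noKinkOfSimple`; Theorems files are capped at 400 lines, so the proof is split helper + main):
**clustering of near-minimisers of the REWARDED torus functional from a strict Ky-Fan gap** (all
measurable `v`, hard cores included; `L > 0`; any reward `s`). If `R(s) = inf_Ψ F_s(Ψ) < ∞` and
`2R(s) + γ ≤ F_s(Φ₁) + F_s(Φ₂)` for all `L²(cell)`-orthogonal pairs of periodic trial states
(`γ > 0`), then any two trial states with `F_s ≤ R(s) + γη/16` satisfy
`∫_cell |Φ − e^{iθ}Φ'|² ≤ η` for some phase `θ` — `NoKink.exists_phase_sq_dist_le_of_kyFanGap` for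
the rewarded form `Q_s(χ) = q(χ) + s·(N‖χ‖² − n₀(χ))`. [folklore] -/
theorem stub_noKinkOfSimpleRewardClustering :
    ∀ (v : ℝ → ENNReal) (N : ℕ) (L s γ η : ℝ), Measurable v → 0 < L → 0 < γ → 0 < η → (⨅ Ψ : Literature.MathematicalPhysics.QuantumManyBody.BoseGas.PeriodicTrialState N L, (Literature.MathematicalPhysics.QuantumManyBody.BoseGas.periodicEnergy v Ψ + ENNReal.ofReal s * ((N : ENNReal) - Literature.MathematicalPhysics.QuantumManyBody.BoseGas.condensateOccupation N L Ψ.ψ))) ≠ ⊤ → (∀ Φ₁ Φ₂ : Literature.MathematicalPhysics.QuantumManyBody.BoseGas.PeriodicTrialState N L, (∫ X in Literature.MathematicalPhysics.QuantumManyBody.BoseGas.cellN N L, starRingEnd ℂ (Φ₁.ψ X) * Φ₂.ψ X) = 0 → 2 * (⨅ Ψ : Literature.MathematicalPhysics.QuantumManyBody.BoseGas.PeriodicTrialState N L, (Literature.MathematicalPhysics.QuantumManyBody.BoseGas.periodicEnergy v Ψ + ENNReal.ofReal s * ((N : ENNReal) - Literature.MathematicalPhysics.QuantumManyBody.BoseGas.condensateOccupation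 N L Ψ.ψ))) + ENNReal.ofReal γ ≤ (Literature.MathematicalPhysics.QuantumManyBody.BoseGas.periodicEnergy v Φ₁ + ENNReal.ofReal s * ((N : ENNReal) - Literature.MathematicalPhysics.QuantumManyBody.BoseGas.condensateOccupation N L Φ₁.ψ)) + (Literature.MathematicalPhysics.QuantumManyBody.BoseGas.periodicEnergy v Φ₂ + ENNReal.ofReal s * ((N : ENNReal) - Literature.MathematicalPhysics.QuantumManyBody.BoseGas.condensateOccupation N L Φ₂.ψ))) → ∀ Φ Φ' : Literature.MathematicalPhysics.QuantumManyBody.BoseGas.PeriodicTrialState N L, Literature.MathematicalPhysics.QuantumManyBody.BoseGas.periodicEnergy v Φ + ENNReal.ofReal s * ((N : ENNReal) - Literature.MathematicalPhysics.QuantumManyBody.BoseGas.condensateOccupation N L Φ.ψ) ≤ (⨅ Ψ : Literature.MathematicalPhysics.QuantumManyBody.BoseGas.PeriodicTrialState N L, (Literature.MathematicalPhysics.QuantumManyBody.BoseGas.periodicEnergy v Ψ + ENNReal.ofReal s * ((N : ENNReal) - Literature.MathematicalPhysics.QuantumManyBody.BoseGas.condensateOccupation N L Ψ.ψ))) + ENNReal.ofReal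 (γ * η / 16) → Literature.MathematicalPhysics.QuantumManyBody.BoseGas.periodicEnergy v Φ' + ENNReal.ofReal s * ((N : ENNReal) - Literature.MathematicalPhysics.QuantumManyBody.BoseGas.condensateOccupation N L Φ'.ψ) ≤ (⨅ Ψ : Literature.MathematicalPhysics.QuantumManyBody.BoseGas.PeriodicTrialState N L, (Literature.MathematicalPhysics.QuantumManyBody.BoseGas.periodicEnergy v Ψ + ENNReal.ofReal s * ((N : ENNReal) - Literature.MathematicalPhysics.QuantumManyBody.BoseGas.condensateOccupation N L Ψ.ψ))) + ENNReal.ofReal (γ * η / 16) → ∃ θ : ℝ, (∫ X in Literature.MathematicalPhysics.QuantumManyBody.BoseGas.cellN N L, ‖Φ.ψ X - Complex.exp (θ * Complex.I) * Φ'.ψ X‖ ^ 2) ≤ η := by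
  intro v N L s γ η hv hL hγ hη hE hgap Φ Φ' hΦ hΦ'
  exact NoKink.exists_phase_sq_dist_le_of_kyFanGap
    (fun Ψ => periodicEnergy v Ψ + ENNReal.ofReal s * ((N : ℝ≥0∞) - condensateOccupation N L Ψ.ψ))
    (fun χ => (∫⁻ X in cellN N L, kineticDensity χ X +
        periodicInteraction v L X * ((‖χ X‖₊ : ℝ≥0∞)) ^ 2) +
      ENNReal.ofReal s * ((N : ℝ≥0∞) * (∫⁻ X in cellN N L, ((‖χ X‖₊ : ℝ≥0∞)) ^ 2) -
        condensateOccupation N L χ))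
    (NoKink.rewardForm_trialState v s) (fun c _ hχ => NoKink.rewardForm_const_mul v L s c hχ)
    (fun _ _ hφ hψ => (NoKink.rewardForm_add_add_sub hv hL s hφ hψ).le) hγ hE hgap hη Φ Φ' hΦ hΦ'

end Summit.AtomisticToContinuum.BoseEinsteinCondensation.Cruxes.RewardChordBound.Birth

end
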